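import Literature.NumberTheory.Automorphic.HidaLatticeDiamondAction
import Literature.NumberTheory.Automorphic.OrdinaryPartOfCompleteModule
import Literature.NumberTheory.Automorphic.CompletedCohomologyGLHecke
import HarnessLib

/-!
# The diamond `𝒪[T(1)/T(b)]`-module structure on the `U_p`-ordinary lattice cohomology

Topic `NumberTheory/Automorphic`; namespaces `Literature.NumberTheory.Automorphic.BigHeckeGLn` and
`…ParallelWeight`; definitions with bodies and theorems, continuing `HidaLatticeDiamondAction`
([Hida1994AIF, §2]; [KhareThorne2017, §6.3: "`H^*_ord(X_{U(b,c)}, ·)` is a module over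
`𝒪[T(1)/T(b)]`"]):

* `uniformizerAt_mem_adicCompletionIntegers`, `heckeElement_one_mem_integralMonoid`,
  **`upElement_mem_integralMonoid`** — the `U_p`-element `α = ∏_{w ∈ s} t_{w,1}^r` lies in the
  integral monoid of the chosen `p`-adic places, so `[U α U]` (`latticeHecke`) and its ordinary part
  `ordPart` are defined on `H = H^i(U(b,c), ⨂_τ Sym^{k−2}(𝒪²))`;
* **`latticeDiamondQuot`** — the diamond action factors through **`T(1)/T(b)`**
  (`QuotientGroup.lift` of `latticeDiamond`, kernel `⊇ T(b)`), i.e. `H` is a representation of the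
  finite group `T(1)/T(b)` over `𝒪` = a module over `𝒪[T(1)/T(b)]` (`Representation.asModule`);
* **`latticeDiamondOrd`**, **`latticeDiamondOrdQuot`** — the same on the `[U α U]`-ORDINARY PART
  `H^{ord} = ⋂ₙ range [UαU]ⁿ` (the diamonds preserve it, `mapsTo_latticeDiamond_ordinaryPart`).

## References

* H. Hida, Ann. Inst. Fourier 44 (1994), §2 (held). [Hida1994AIF]
* C. Khare, J. A. Thorne, Amer. J. Math. 139 (2017), §6.3 (arXiv:1409.7007, held). [KhareThorne2017]
-/

noncomputable section

open CategoryTheory IsDedekindDomain NumberField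

namespace Literature.NumberTheory.Automorphic

namespace BigHeckeGLn

variable {K : Type} [Field K] [NumberField K]

/-- The fixed uniformiser is integral. [folklore] -/
theorem uniformizerAt_mem_adicCompletionIntegers (v : HeightOneSpectrum (𝓞 K)) :
    ((uniformizerAt v : (v.adicCompletion K)ˣ) : v.adicCompletion K) ∈ v.adicCompletionIntegers K := by
  rw [HeightOneSpectrum.mem_adicCompletionIntegers]
  change Valued.v ((Classical.choose (v.valuation_exists_uniformizer K) : K) : v.adicCompletion K) ≤ 1
  rw [HeightOneSpectrum.valuedAdicCompletion_eq_valuation', Classical.choose_spec (v.valuation_exists_uniformizer K),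
    ← WithZero.exp_zero, WithZero.exp_le_exp]
  decide

end BigHeckeGLn

namespace ParallelWeight

open BigHeckeGLn IntegralWeightGL2 LevelAction

variable (F : Type) [Field F] [NumberField F] (k : ℕ) (p : ℕ) [Fact p.Prime]

/-- **`t_{w,1}` lies in the integral monoid** of the chosen `p`-adic places. [folklore] -/
theorem heckeElement_one_mem_integralMonoid (w : HeightOneSpectrum (𝓞 F)) :
    heckeElement 2 F w 1 ∈ integralMonoid F (padicPlace F p) :=
  (mem_integralMonoid_iff _).2 fun τ => by
    by_cases h : padicPlace F p τ = w
    · rw [mem_integralAt_iff]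
      intro i j
      rw [h, heckeElement_eq_ofLocal, localComponent_ofLocal, coe_glDiagonal, Matrix.diagonal_apply]
      split_ifs
      · exact uniformizerAt_mem_adicCompletionIntegers w
      · exact Subring.one_mem _
      · exact Subring.zero_mem _
    · rw [localComponent_heckeElement_of_ne h]
      exact Submonoid.one_mem _

/-- **`∏_{w ∈ s} t_{w,1}^r` lies in the integral monoid.** [folklore] -/
theorem upElement_mem_integralMonoid (s : Finset (HeightOneSpectrum (𝓞 F))) (r : ℕ) :
    TameLevel.upElement s r ∈ integralMonoid F (padicPlace F p) :=
  Submonoid.noncommProd_mem _ _ _ _ fun w _ => pow_mem (heckeElement_one_mem_integralMonoid F p w) r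

variable {𝒰 : TameLevel 2 F p} (h𝒰 : 𝒰.IsMaximalAbove) (b c i : ℕ)

/-- **`T(b) = ∏_{v ∣ p} T_v(b)`** inside `T(1) = ∏_{v ∣ p} T_2(𝒪_v)`. [cite: KhareThorne2017, §6.3] -/
abbrev torusBallPi (b : ℕ) : Subgroup (∀ v : PlacesAbove F p, (Fin 2 → (v.1.adicCompletionIntegers F)ˣ)) :=
  Subgroup.pi Set.univ fun v => torusBall (n := 2) v.1 b

/-- `T(b)` acts trivially through the diamonds. [folklore] -/
theorem torusBallPi_le_ker_latticeDiamond :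
    torusBallPi F p b ≤ (latticeDiamond F k p h𝒰 b c i).ker := fun _ hu =>
  latticeDiamond_eq_one_of_mem F k p h𝒰 b c i fun v => hu v (Set.mem_univ _)

/-- **The diamond action of the FINITE group `T(1)/T(b)` on `H^i(U(b,c), ⨂_τ Sym^{k−2}(𝒪²))`** — an
`𝒪`-linear representation, i.e. an `𝒪[T(1)/T(b)]`-module structure (`Representation.asModule`).
[cite: KhareThorne2017, §6.3] [cite: Hida1994AIF, §2] -/
def latticeDiamondQuot :
    Representation (padicEmbInt F p)
      ((∀ v : PlacesAbove F p, (Fin 2 → (v.1.adicCompletionIntegers F)ˣ)) ⧸ torusBallPi F p b)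
      (LevelAction.cohomology (globalEmbedding 2 F) (integralMonoid F (padicPlace F p))
        (symLatticeAction (padicEmbInt F p) (PadicAlgCl p) F k (padicPlace F p) (padicEmbIntHom F p))
        (𝒰.level b c) i) :=
  QuotientGroup.lift _ (latticeDiamond F k p h𝒰 b c i) (torusBallPi_le_ker_latticeDiamond F k p h𝒰 b c i)

/-- Unfolding `latticeDiamondQuot` on classes. [folklore] -/
@[simp]
theorem latticeDiamondQuot_mk (u : ∀ v : PlacesAbove F p, (Fin 2 → (v.1.adicCompletionIntegers F)ˣ)) :
    latticeDiamondQuot F k p h𝒰 b c i (u : _ ⧸ torusBallPi F p b) = latticeDiamond F k p h𝒰 b c i u :=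
  rfl

variable (s : Finset (HeightOneSpectrum (𝓞 F))) (r : ℕ)

/-- **The diamonds restricted to the `[U α U]`-ordinary part**, `α = ∏_{w ∈ s} t_{w,1}^r`: a
representation of `T(1)` on `H^{ord} = ⋂ₙ range [UαU]ⁿ`. [cite: KhareThorne2017, §6.3] -/
def latticeDiamondOrd :
    Representation (padicEmbInt F p) (∀ v : PlacesAbove F p, (Fin 2 → (v.1.adicCompletionIntegers F)ˣ))
      (ordPart (latticeHecke F k p 𝒰 b c i (upElement_mem_integralMonoid F p s r))) where
  toFun u := (latticeDiamond F k p h𝒰 b c i u).restrict fun x hx =>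
    mapsTo_latticeDiamond_ordinaryPart F k p h𝒰 b c i (upElement_mem_integralMonoid F p s r)
      (fun u' => commute_diamondPi_upElement p u' s r) u hx
  map_one' := by
    refine LinearMap.ext fun x => Subtype.ext ?_
    simp only [map_one, LinearMap.coe_restrict_apply, Module.End.one_apply]
  map_mul' u u' := by
    refine LinearMap.ext fun x => Subtype.ext ?_
    simp only [map_mul, LinearMap.coe_restrict_apply, Module.End.mul_apply]

/-- Unfolding `latticeDiamondOrd`. [folklore] -/
@[simp]
theorem coe_latticeDiamondOrd_apply (u : ∀ v : PlacesAbove F p, (Fin 2 → (v.1.adicCompletionIntegers F)ˣ))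
    (x : ordPart (latticeHecke F k p 𝒰 b c i (upElement_mem_integralMonoid F p s r))) :
    (latticeDiamondOrd F k p h𝒰 b c i s r u x : LevelAction.cohomology (globalEmbedding 2 F)
        (integralMonoid F (padicPlace F p))
        (symLatticeAction (padicEmbInt F p) (PadicAlgCl p) F k (padicPlace F p) (padicEmbIntHom F p)) (𝒰.level b c) i) =
      latticeDiamond F k p h𝒰 b c i u x :=
  rfl

/-- `T(b)` acts trivially on the ordinary part. [folklore] -/
theorem torusBallPi_le_ker_latticeDiamondOrd :
    torusBallPi F p b ≤ (latticeDiamondOrd F k p h𝒰 b c i s r).ker := fun u hu => by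
  rw [MonoidHom.mem_ker]
  refine LinearMap.ext fun x => Subtype.ext ?_
  rw [coe_latticeDiamondOrd_apply, latticeDiamond_eq_one_of_mem F k p h𝒰 b c i fun v => hu v (Set.mem_univ _)]
  rfl

/-- **`H^{ord}` as a representation of `T(1)/T(b)` over `𝒪`** (an `𝒪[T(1)/T(b)]`-module).
[cite: KhareThorne2017, §6.3] [cite: Hida1994AIF, §2] -/
def latticeDiamondOrdQuot :
    Representation (padicEmbInt F p)
      ((∀ v : PlacesAbove F p, (Fin 2 → (v.1.adicCompletionIntegers F)ˣ)) ⧸ torusBallPi F p b)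
      (ordPart (latticeHecke F k p 𝒰 b c i (upElement_mem_integralMonoid F p s r))) :=
  QuotientGroup.lift _ (latticeDiamondOrd F k p h𝒰 b c i s r) (torusBallPi_le_ker_latticeDiamondOrd F k p h𝒰 b c i s r)

/-- Unfolding `latticeDiamondOrdQuot` on classes. [folklore] -/
@[simp]
theorem latticeDiamondOrdQuot_mk (u : ∀ v : PlacesAbove F p, (Fin 2 → (v.1.adicCompletionIntegers F)ˣ)) :
    latticeDiamondOrdQuot F k p h𝒰 b c i s r (u : _ ⧸ torusBallPi F p b) = latticeDiamondOrd F k p h𝒰 b c i s r u :=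
  rfl

end ParallelWeight

end Literature.NumberTheory.Automorphic
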